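import Literature.Topology.FourManifolds.TorusKnotMilnorFibreAffine
import Literature.AlgebraicTopology.SingularHomology.MayerVietorisBettiOne
import Mathlib.Analysis.SpecialFunctions.Pow.Continuity
import Mathlib.RingTheory.RootsOfUnity.Complex
import HarnessLib

/-!
# `H₁` of the affine Milnor fibre `U^q - V^p = 1` is free of rank `(p-1)(q-1)` (Milnor 1968, Thm. 9.1)

Topic `Literature/Topology/FourManifolds`; fact seat
`provefact-Literature.Topology.FourManifolds.sliceGenus_torusKnot`, fourth file of the upper bound
(sequel of `TorusKnotMilnorFibreAffine.lean`).  Everything here is **proved**; no named fact is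
introduced (D-0026).

J. Milnor, *Singular points of complex hypersurfaces* (1968), Thm. 9.1 (Brieskorn–Pham, PDF
p. 39): *"The group `HₙF_θ` is free abelian of rank `μ = (a₁ - 1)(a₂ - 1) ⋯ (aₙ₊₁ - 1)`"*; for
`n = 1`, `(a₁, a₂) = (q, p)`: `rank H₁ = (p-1)(q-1)`.  Milnor's proof deformation retracts the
affine fibre onto the join `Ω_q * Ω_p` of the roots of unity (Lemma 9.2, Pham).  Here the same
number is obtained by a Mayer–Vietoris argument adapted to the tree: the affine fibre
`F' = {U^q - V^p = 1}` (`TorusKnotMilnor.affFibre`) is covered by the open sets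
`A = {Re U^q < 2/3}` and `B = {Re U^q > 1/3}`; on `A` the second coordinate is
`V = c · ν · (1 - U^q)^{1/p}` with `c^p = 1` (principal root, continuous since `Re (1 - U^q) > 1/3`;
`ν^p = -1`), so that the `p`-th root of unity `c` is locally constant and contracting `U` to `0`
deformation retracts `A` onto the `p` points `(0, ν Ω_p)` — `A ≃ Ω_p` (`homotopyEquivA`);
symmetrically `B ≃ Ω_q` and `A ∩ B ≃ Ω_q × Ω_p` (deforming `U^q` to `1/2`).  The end of the
Mayer–Vietoris sequence (`mayerVietoris_finrank_one`, `MayerVietorisBettiOne.lean`) then gives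
`rank H₁(F'; ℤ) + p + q = pq + 1`, i.e. **`rank_ℤ H₁(F'; ℤ) = (p-1)(q-1)`**
(`finrank_singularHomology_one_affFibre`), and `F'` is path connected
(`pathConnectedSpace_affFibre`: every point is joined inside `A` or `B` to one of the base points,
which are joined through `A ∩ B`).

## References

* J. Milnor, *Singular points of complex hypersurfaces*, Ann. of Math. Studies 61 (1968), §9,
  Thm. 9.1 and Lemma 9.2 (PDF pp. 39–41). [Milnor1968]
* A. Hatcher, *Algebraic Topology*, CUP 2002, §2.2 pp. 149–150 (Mayer–Vietoris). [HatcherAT2002]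
-/

open scoped Manifold ContDiff Topology unitInterval
open Function Set Filter
open Literature.AlgebraicTopology.SingularHomology CategoryTheory Limits

noncomputable section

namespace Literature.Topology.FourManifolds

/-- Local notation: `𝔼 n` is the model Euclidean space `EuclideanSpace ℝ (Fin n)`. -/
local notation "𝔼 " n:arg => EuclideanSpace ℝ (Fin n)

namespace TorusKnotMilnor

open TorusKnotEmbedding

/-! ### Points of `ℂ² = ℝ⁴` with prescribed complex coordinates -/

/-- The point of `ℝ⁴` with complex coordinates `(U, V) = (a, b)`. [folklore] -/
def mkPt (a b : ℂ) : 𝔼 4 := WithLp.toLp 2 ![a.re / √2, a.im / √2, b.re / √2, b.im / √2]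

/-- `U(mkPt a b) = a`. [folklore] -/
@[simp] theorem firstComplexCoord_mkPt (a b : ℂ) : firstComplexCoord (mkPt a b) = a := by
  have h : (√2 : ℝ) ≠ 0 := by positivity
  apply Complex.ext <;> simp [mkPt, mul_div_cancel₀ _ h]

/-- `V(mkPt a b) = b`. [folklore] -/
@[simp] theorem secondComplexCoord_mkPt (a b : ℂ) : secondComplexCoord (mkPt a b) = b := by
  have h : (√2 : ℝ) ≠ 0 := by positivity
  apply Complex.ext <;> simp [mkPt, mul_div_cancel₀ _ h]

/-- A point of `ℝ⁴` is `mkPt` of its complex coordinates. [folklore] -/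
theorem mkPt_coord (y : 𝔼 4) : mkPt (firstComplexCoord y) (secondComplexCoord y) = y :=
  eq_of_coord_eq (by simp) (by simp)

/-- `mkPt` is continuous. [folklore] -/
theorem continuous_mkPt : Continuous fun z : ℂ × ℂ => mkPt z.1 z.2 := by
  unfold mkPt
  refine (PiLp.continuous_toLp 2 _).comp (continuous_pi fun i => ?_)
  fin_cases i <;> simp <;> fun_prop

/-- `f(mkPt a b) = a^q - b^p`. [folklore] -/
theorem milnorPoly_mkPt (p q : ℕ) (a b : ℂ) : milnorPoly p q (mkPt a b) = a ^ q - b ^ p := by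
  simp [milnorPoly]

/-! ### Principal roots on the right half-plane, roots of unity -/

/-- The principal `n`-th root `z ↦ z^{1/n}`. [folklore] -/
def prRoot (n : ℕ) (z : ℂ) : ℂ := z ^ ((n : ℂ)⁻¹)

/-- `(z^{1/n})^n = z` (`n ≠ 0`). [folklore] -/
theorem prRoot_pow {n : ℕ} (hn : n ≠ 0) (z : ℂ) : prRoot n z ^ n = z := Complex.cpow_nat_inv_pow z hn

/-- `1^{1/n} = 1`. [folklore] -/
@[simp] theorem prRoot_one (n : ℕ) : prRoot n 1 = 1 := Complex.one_cpow _

/-- `z^{1/n} ≠ 0` for `z ≠ 0`. [folklore] -/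
theorem prRoot_ne_zero {n : ℕ} (hn : n ≠ 0) {z : ℂ} (hz : z ≠ 0) : prRoot n z ≠ 0 := fun h => by
  have := prRoot_pow hn z
  rw [h, zero_pow hn] at this
  exact hz this.symm

/-- The principal root is continuous on the open right half-plane (inside the slit plane).
[folklore] -/
theorem continuousOn_prRoot (n : ℕ) : ContinuousOn (prRoot n) {z : ℂ | 0 < z.re} := fun _ hz =>
  (continuousAt_cpow_const (Complex.mem_slitPlane_iff.2 (Or.inl hz))).continuousWithinAt

/-- The standard primitive `n`-th root of unity `μ = e^{2πi/n}`. [folklore] -/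
def rootU (n : ℕ) : ℂ := Complex.exp (2 * Real.pi * Complex.I / n)

/-- `μ` is a primitive `n`-th root of unity (`n ≠ 0`). [folklore] -/
theorem isPrimitiveRoot_rootU {n : ℕ} (hn : n ≠ 0) : IsPrimitiveRoot (rootU n) n :=
  Complex.isPrimitiveRoot_exp n hn

/-- `μ^n = 1`. [folklore] -/
theorem rootU_pow_self {n : ℕ} (hn : n ≠ 0) : rootU n ^ n = 1 := (isPrimitiveRoot_rootU hn).pow_eq_one

/-- `(μ^k)^n = 1`. [folklore] -/
theorem rootU_pow_pow {n : ℕ} (hn : n ≠ 0) (k : ℕ) : (rootU n ^ k) ^ n = 1 := by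
  rw [← pow_mul, mul_comm, pow_mul, rootU_pow_self hn, one_pow]

/-- `μ ≠ 0`. [folklore] -/
theorem rootU_ne_zero (n : ℕ) : rootU n ≠ 0 := Complex.exp_ne_zero _

/-- Every `n`-th root of unity is a power `μ^k`, `k < n`. [folklore] -/
theorem exists_rootU_pow_eq {n : ℕ} (hn : n ≠ 0) {w : ℂ} (hw : w ^ n = 1) :
    ∃ k : Fin n, rootU n ^ (k : ℕ) = w := by
  haveI : NeZero n := ⟨hn⟩
  obtain ⟨i, hi, h⟩ := (isPrimitiveRoot_rootU hn).eq_pow_of_pow_eq_one hw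
  exact ⟨⟨i, hi⟩, h⟩

/-- Distinct exponents `k < n` give distinct powers `μ^k`. [folklore] -/
theorem rootU_pow_injective {n : ℕ} (hn : n ≠ 0) : Injective fun k : Fin n => rootU n ^ (k : ℕ) :=
  fun k l h => Fin.ext ((isPrimitiveRoot_rootU hn).pow_inj k.2 l.2 h)

/-- **The exponent of a root of unity**: `rootIdx w = k` with `μ^k = w` (junk value `0` if `w` is
not an `n`-th root of unity). [folklore] -/
def rootIdx {n : ℕ} (hn : n ≠ 0) (w : ℂ) : Fin n :=
  if h : ∃ k : Fin n, rootU n ^ (k : ℕ) = w then h.choose else ⟨0, Nat.pos_of_ne_zero hn⟩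

/-- `μ^(rootIdx w) = w` for an `n`-th root of unity `w`. [folklore] -/
theorem rootU_pow_rootIdx {n : ℕ} (hn : n ≠ 0) {w : ℂ} (hw : w ^ n = 1) :
    rootU n ^ (rootIdx hn w : ℕ) = w := by
  have h := exists_rootU_pow_eq hn hw
  rw [rootIdx, dif_pos h]
  exact h.choose_spec

/-- `rootIdx (μ^k) = k`. [folklore] -/
theorem rootIdx_rootU_pow {n : ℕ} (hn : n ≠ 0) (k : Fin n) : rootIdx hn (rootU n ^ (k : ℕ)) = k :=
  rootU_pow_injective hn (rootU_pow_rootIdx hn (rootU_pow_pow hn k))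

/-- The set of `n`-th roots of unity is finite. [folklore] -/
theorem finite_rootsOfUnity_set {n : ℕ} (hn : n ≠ 0) : {w : ℂ | w ^ n = 1}.Finite :=
  (Set.finite_range fun k : Fin n => rootU n ^ (k : ℕ)).subset fun w hw =>
    ⟨rootIdx hn w, rootU_pow_rootIdx hn hw⟩

/-- **A continuous map whose values are roots of unity has continuous exponent** (its range is
finite, hence discrete). [folklore] -/
theorem continuous_rootIdx_comp {n : ℕ} (hn : n ≠ 0) {Y : Type*} [TopologicalSpace Y] {g : Y → ℂ}
    (hg : Continuous g) (hg1 : ∀ y, g y ^ n = 1) : Continuous fun y => rootIdx hn (g y) := by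
  haveI : Finite ↥(Set.range g) :=
    ((finite_rootsOfUnity_set hn).subset (by rintro _ ⟨y, rfl⟩; exact hg1 y)).to_subtype
  have hfac : (fun y => rootIdx hn (g y)) = (fun w : ↥(Set.range g) => rootIdx hn w) ∘ Set.rangeFactorization g :=
    rfl
  rw [hfac]
  exact continuous_of_discreteTopology.comp hg.rangeFactorization

/-- The half root `ν = e^{πi/n}`, with `ν^n = -1`. [folklore] -/
def halfRoot (n : ℕ) : ℂ := Complex.exp (Real.pi * Complex.I / n)

/-- `ν^n = -1` (`n ≠ 0`). [folklore] -/
theorem halfRoot_pow {n : ℕ} (hn : n ≠ 0) : halfRoot n ^ n = -1 := by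
  rw [halfRoot, ← Complex.exp_nat_mul, mul_div_cancel₀ _ (Nat.cast_ne_zero.2 hn), Complex.exp_pi_mul_I]

/-- `ν ≠ 0`. [folklore] -/
theorem halfRoot_ne_zero (n : ℕ) : halfRoot n ≠ 0 := Complex.exp_ne_zero _

/-! ### The affine fibre, its coordinates and the cover `A ∪ B` -/

section Cover

variable {p q : ℕ}

/-- The first complex coordinate on the affine fibre. [folklore] -/
def cU (y : ↥(affFibre p q)) : ℂ := firstComplexCoord (y : 𝔼 4)

/-- The second complex coordinate on the affine fibre. [folklore] -/
def cV (y : ↥(affFibre p q)) : ℂ := secondComplexCoord (y : 𝔼 4)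

/-- `P = U^q` on the affine fibre. [folklore] -/
def cP (y : ↥(affFibre p q)) : ℂ := cU y ^ q

/-- On the affine fibre `V^p = U^q - 1`. [folklore] -/
theorem cV_pow (y : ↥(affFibre p q)) : cV y ^ p = cP y - 1 := by
  have h : cU y ^ q - cV y ^ p = 1 := y.2
  rw [cP]; linear_combination -h

/-- `U`, `V`, `P` are continuous on the fibre. [folklore] -/
theorem continuous_cU : Continuous (cU (p := p) (q := q)) := firstComplexCoord.continuous.comp continuous_subtype_val

/-- `V` is continuous on the fibre. [folklore] -/
theorem continuous_cV : Continuous (cV (p := p) (q := q)) := secondComplexCoord.continuous.comp continuous_subtype_val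

/-- `P` is continuous on the fibre. [folklore] -/
theorem continuous_cP : Continuous (cP (p := p) (q := q)) := continuous_cU.pow q

/-- A point of the fibre is `mkPt` of its coordinates. [folklore] -/
theorem mkPt_cU_cV (y : ↥(affFibre p q)) : mkPt (cU y) (cV y) = (y : 𝔼 4) := mkPt_coord _

/-- Points of the fibre with prescribed coordinates: `mkPt a b ∈ F'` iff `a^q - b^p = 1`. [folklore] -/
theorem mkPt_mem_affFibre {a b : ℂ} (h : a ^ q - b ^ p = 1) : mkPt a b ∈ affFibre p q := by
  rw [mem_affFibre, milnorPoly_mkPt, h]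

variable (p q) in
/-- **The piece `A = {Re U^q < 2/3}`** of the affine fibre. [folklore] -/
def pieceA : Set ↥(affFibre p q) := {y | (cP y).re < 2 / 3}

variable (p q) in
/-- **The piece `B = {Re U^q > 1/3}`** of the affine fibre. [folklore] -/
def pieceB : Set ↥(affFibre p q) := {y | 1 / 3 < (cP y).re}

/-- `A` is open. [folklore] -/
theorem isOpen_pieceA : IsOpen (pieceA p q) := isOpen_lt (Complex.continuous_re.comp continuous_cP) continuous_const

/-- `B` is open. [folklore] -/
theorem isOpen_pieceB : IsOpen (pieceB p q) := isOpen_lt continuous_const (Complex.continuous_re.comp continuous_cP)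

/-- `A ∪ B` is everything. [folklore] -/
theorem pieceA_union_pieceB : pieceA p q ∪ pieceB p q = univ :=
  eq_univ_of_forall fun y => by
    by_cases h : (cP y).re < 2 / 3
    · exact Or.inl h
    · exact Or.inr (by change 1 / 3 < (cP y).re; linarith [not_lt.1 h])

/-- On `A`, `Re (1 - P) > 1/3 > 0`. [folklore] -/
theorem re_one_sub_cP_pos {y : ↥(affFibre p q)} (hy : y ∈ pieceA p q) : 0 < (1 - cP y).re := by
  have h : (cP y).re < 2 / 3 := hy
  simp only [Complex.sub_re, Complex.one_re]; linarith

/-- On `B`, `Re P > 0`. [folklore] -/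
theorem re_cP_pos {y : ↥(affFibre p q)} (hy : y ∈ pieceB p q) : 0 < (cP y).re := by
  have h : 1 / 3 < (cP y).re := hy
  linarith

end Cover

/-! ### The piece `A` deformation retracts onto `p` points -/

section PieceA

variable {p q : ℕ}

/-- **The angular part of `V` on `A`**: `c = V / (ν (1 - U^q)^{1/p})`, a `p`-th root of unity.
[folklore] -/
def angA (y : ↥(pieceA p q)) : ℂ := cV y.1 / (halfRoot p * prRoot p (1 - cP y.1))

/-- The denominator `ν (1 - P)^{1/p}` does not vanish on `A`. [folklore] -/
theorem denA_ne_zero (hp : p ≠ 0) (y : ↥(pieceA p q)) : halfRoot p * prRoot p (1 - cP y.1) ≠ 0 :=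
  mul_ne_zero (halfRoot_ne_zero p) (prRoot_ne_zero hp fun h => by
    have := re_one_sub_cP_pos y.2; rw [h, Complex.zero_re] at this; exact lt_irrefl _ this)

/-- `(ν (1 - P)^{1/p})^p = P - 1`. [folklore] -/
theorem denA_pow (hp : p ≠ 0) (y : ↥(pieceA p q)) : (halfRoot p * prRoot p (1 - cP y.1)) ^ p = cP y.1 - 1 := by
  rw [mul_pow, halfRoot_pow hp, prRoot_pow hp]; ring

/-- **`c^p = 1` on `A`.** [folklore] -/
theorem angA_pow (hp : p ≠ 0) (y : ↥(pieceA p q)) : angA y ^ p = 1 := by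
  rw [angA, div_pow, denA_pow hp, cV_pow, div_self]
  rw [← denA_pow hp]
  exact pow_ne_zero _ (denA_ne_zero hp y)

/-- `V = c · ν (1 - P)^{1/p}` on `A`. [folklore] -/
theorem cV_eq_angA_mul (hp : p ≠ 0) (y : ↥(pieceA p q)) : cV y.1 = angA y * (halfRoot p * prRoot p (1 - cP y.1)) := by
  rw [angA, div_mul_cancel₀ _ (denA_ne_zero hp y)]

/-- The angular part is continuous on `A`. [folklore] -/
theorem continuous_angA (hp : p ≠ 0) : Continuous (angA (p := p) (q := q)) := by
  have h1 : Continuous fun y : ↥(pieceA p q) => cV y.1 := continuous_cV.comp continuous_subtype_val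
  have h2 : Continuous fun y : ↥(pieceA p q) => prRoot p (1 - cP y.1) :=
    (continuousOn_prRoot p).comp_continuous
      (continuous_const.sub (continuous_cP.comp continuous_subtype_val)) fun y => re_one_sub_cP_pos y.2
  exact h1.div (continuous_const.mul h2) (denA_ne_zero hp)

/-- **The index map `A → Fin p`** (the exponent of the angular part). [folklore] -/
def idxA (hp : p ≠ 0) : C(↥(pieceA p q), Fin p) :=
  ⟨fun y => rootIdx hp (angA y), continuous_rootIdx_comp hp (continuous_angA hp) (angA_pow hp)⟩

/-- The `k`-th base point `(0, ν μ^k)` of `A`, as a point of the fibre: `0^q - (ν μ^k)^p = 1`.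
[folklore] -/
theorem basePtA_mem (hp : p ≠ 0) (hq : q ≠ 0) (k : ℕ) : mkPt 0 (halfRoot p * rootU p ^ k) ∈ affFibre p q :=
  mkPt_mem_affFibre (by rw [zero_pow hq, mul_pow, halfRoot_pow hp, rootU_pow_pow hp]; ring)

/-- The base points lie in `A` (`Re U^q = 0`). [folklore] -/
theorem basePtA_mem_pieceA (hp : p ≠ 0) (hq : q ≠ 0) (k : ℕ) :
    (⟨mkPt 0 (halfRoot p * rootU p ^ k), basePtA_mem hp hq k⟩ : ↥(affFibre p q)) ∈ pieceA p q := by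
  show (cP _).re < 2 / 3
  rw [cP, cU]
  simp [zero_pow hq]

/-- **The section `Fin p → A`**, `k ↦ (0, ν μ^k)`. [folklore] -/
def secA (hp : p ≠ 0) (hq : q ≠ 0) : C(Fin p, ↥(pieceA p q)) :=
  ⟨fun k => ⟨⟨mkPt 0 (halfRoot p * rootU p ^ (k : ℕ)), basePtA_mem hp hq k⟩, basePtA_mem_pieceA hp hq k⟩,
    continuous_of_discreteTopology⟩

/-- `idx ∘ sec = id`: the angular part of the `k`-th base point is `μ^k`. [folklore] -/
theorem idxA_secA (hp : p ≠ 0) (hq : q ≠ 0) (k : Fin p) : idxA hp (secA hp hq k) = k := by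
  show rootIdx hp (angA (secA hp hq k)) = k
  have h : angA (secA hp hq k) = rootU p ^ (k : ℕ) := by
    rw [angA]
    show secondComplexCoord (mkPt 0 _) / (halfRoot p * prRoot p (1 - firstComplexCoord (mkPt 0 _) ^ q)) = _
    rw [secondComplexCoord_mkPt, firstComplexCoord_mkPt, zero_pow hq, sub_zero, prRoot_one, mul_one,
      mul_div_cancel_left₀ _ (halfRoot_ne_zero p)]
  rw [h, rootIdx_rootU_pow]

/-- **The deformation of `A`**: `Φ(s, y) = (s U, c ν (1 - sᵠ U^q)^{1/p})`, `s ∈ [0, 1]` — at `s = 1`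
the point `y`, at `s = 0` the base point `(0, ν c)`. [cite: Milnor1968, §9 Lemma 9.2 (Pham)] -/
def defA (s : ℝ) (y : ↥(pieceA p q)) : 𝔼 4 :=
  mkPt ((s : ℂ) * cU y.1) (angA y * (halfRoot p * prRoot p (1 - ((s : ℂ) * cU y.1) ^ q)))

/-- Along the deformation `Re (1 - (sU)^q) > 1/3` for `s ∈ [0,1]`. [folklore] -/
theorem re_one_sub_pow_pos {s : ℝ} (hs0 : 0 ≤ s) (hs1 : s ≤ 1) (y : ↥(pieceA p q)) :
    1 / 3 < (1 - ((s : ℂ) * cU y.1) ^ q).re := by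
  have hP : (cP y.1).re < 2 / 3 := y.2
  have hsq0 : 0 ≤ s ^ q := pow_nonneg hs0 q
  have hsq1 : s ^ q ≤ 1 := pow_le_one₀ hs0 hs1
  rw [mul_pow, ← Complex.ofReal_pow, Complex.sub_re, Complex.one_re, Complex.re_ofReal_mul]
  change 1 / 3 < 1 - s ^ q * (cP y.1).re
  rcases le_or_gt 0 (cP y.1).re with h | h
  · nlinarith
  · nlinarith

/-- The deformation stays in the fibre. [folklore] -/
theorem defA_mem (hp : p ≠ 0) (s : ℝ) (y : ↥(pieceA p q)) : defA s y ∈ affFibre p q := by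
  apply mkPt_mem_affFibre
  rw [mul_pow (angA y), angA_pow hp, one_mul, mul_pow (halfRoot p), halfRoot_pow hp, prRoot_pow hp]
  ring

/-- The deformation stays in `A` for `s ∈ [0, 1]`. [folklore] -/
theorem defA_mem_pieceA (hp : p ≠ 0) {s : ℝ} (hs0 : 0 ≤ s) (hs1 : s ≤ 1) (y : ↥(pieceA p q)) :
    (⟨defA s y, defA_mem hp s y⟩ : ↥(affFibre p q)) ∈ pieceA p q := by
  show (cP _).re < 2 / 3
  have h := re_one_sub_pow_pos hs0 hs1 y (q := q)
  rw [Complex.sub_re, Complex.one_re] at h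
  rw [cP, cU]
  change (firstComplexCoord (mkPt _ _) ^ q).re < 2 / 3
  rw [firstComplexCoord_mkPt]
  linarith

/-- The deformation as a map `[0,1] × A → A`. [folklore] -/
def defAMap (hp : p ≠ 0) (z : I × ↥(pieceA p q)) : ↥(pieceA p q) :=
  ⟨⟨defA z.1 z.2, defA_mem hp z.1 z.2⟩, defA_mem_pieceA hp z.1.2.1 z.1.2.2 z.2⟩

/-- The deformation is continuous. [folklore] -/
theorem continuous_defAMap (hp : p ≠ 0) : Continuous (defAMap (p := p) (q := q) hp) := by
  refine Continuous.subtype_mk (Continuous.subtype_mk ?_ _) _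
  have hs : Continuous fun z : I × ↥(pieceA p q) => ((z.1 : ℝ) : ℂ) :=
    Complex.continuous_ofReal.comp (continuous_subtype_val.comp continuous_fst)
  have hU : Continuous fun z : I × ↥(pieceA p q) => cU z.2.1 :=
    continuous_cU.comp (continuous_subtype_val.comp continuous_snd)
  have hsU : Continuous fun z : I × ↥(pieceA p q) => ((z.1 : ℝ) : ℂ) * cU z.2.1 := hs.mul hU
  have hroot : Continuous fun z : I × ↥(pieceA p q) => prRoot p (1 - (((z.1 : ℝ) : ℂ) * cU z.2.1) ^ q) :=
    (continuousOn_prRoot p).comp_continuous (continuous_const.sub (hsU.pow q)) fun z =>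
      lt_trans (by norm_num) (re_one_sub_pow_pos z.1.2.1 z.1.2.2 z.2)
  have hang : Continuous fun z : I × ↥(pieceA p q) => angA z.2 := (continuous_angA hp).comp continuous_snd
  exact continuous_mkPt.comp (hsU.prodMk (hang.mul (continuous_const.mul hroot)))

/-- At `s = 1` the deformation is the identity. [folklore] -/
theorem defA_one (hp : p ≠ 0) (y : ↥(pieceA p q)) : defA 1 y = (y.1 : 𝔼 4) := by
  rw [defA, Complex.ofReal_one, one_mul, ← cP, ← cV_eq_angA_mul hp, mkPt_cU_cV]

/-- At `s = 0` the deformation is the base point `sec (idx y)`. [folklore] -/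
theorem defA_zero (hp : p ≠ 0) (hq : q ≠ 0) (y : ↥(pieceA p q)) : defA 0 y = ((secA hp hq (idxA hp y)).1 : 𝔼 4) := by
  rw [defA, Complex.ofReal_zero, zero_mul, zero_pow hq, sub_zero, prRoot_one, mul_one]
  show mkPt 0 (angA y * halfRoot p) = mkPt 0 (halfRoot p * rootU p ^ (rootIdx hp (angA y) : ℕ))
  rw [rootU_pow_rootIdx hp (angA_pow hp y), mul_comm]

/-- **The homotopy `id_A ≃ sec ∘ idx`** (Milnor 1968, Lemma 9.2: the fibre deformation retracts onto
the join of the roots of unity; here its piece `A` onto `p` points). [cite: Milnor1968, §9 Lemma 9.2] -/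
def homotopyA (hp : p ≠ 0) (hq : q ≠ 0) :
    ContinuousMap.Homotopy (ContinuousMap.id ↥(pieceA p q)) ((secA hp hq).comp (idxA hp)) where
  toFun z := defAMap hp (σ z.1, z.2)
  continuous_toFun := (continuous_defAMap hp).comp ((unitInterval.continuous_symm.comp continuous_fst).prodMk continuous_snd)
  map_zero_left y := by
    apply Subtype.ext; apply Subtype.ext
    show defA (σ 0 : ℝ) y = (y.1 : 𝔼 4)
    rw [unitInterval.symm_zero, Set.Icc.coe_one, defA_one hp]
  map_one_left y := by
    apply Subtype.ext; apply Subtype.ext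
    show defA (σ 1 : ℝ) y = ((secA hp hq (idxA hp y)).1 : 𝔼 4)
    rw [unitInterval.symm_one, Set.Icc.coe_zero, defA_zero hp hq]

/-- **`A ≃ Fin p`**, a homotopy equivalence. [cite: Milnor1968, §9 Lemma 9.2] -/
def homotopyEquivA (hp : p ≠ 0) (hq : q ≠ 0) : ContinuousMap.HomotopyEquiv ↥(pieceA p q) (Fin p) where
  toFun := idxA hp
  invFun := secA hp hq
  left_inv := ⟨(homotopyA hp hq).symm⟩
  right_inv := by
    have h : (idxA hp).comp (secA hp hq) = ContinuousMap.id (Fin p) := ContinuousMap.ext (idxA_secA hp hq)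
    rw [h]

end PieceA

/-! ### The piece `B` deformation retracts onto `q` points -/

section PieceB

variable {p q : ℕ}

/-- On `B`, `P ≠ 0`. [folklore] -/
theorem cP_ne_zero (y : ↥(pieceB p q)) : cP y.1 ≠ 0 := fun h => by
  have := re_cP_pos y.2; rw [h, Complex.zero_re] at this; exact lt_irrefl _ this

/-- **The angular part of `U` on `B`**: `c = U / (U^q)^{1/q}`, a `q`-th root of unity. [folklore] -/
def angB (y : ↥(pieceB p q)) : ℂ := cU y.1 / prRoot q (cP y.1)

/-- **`c^q = 1` on `B`.** [folklore] -/
theorem angB_pow (hq : q ≠ 0) (y : ↥(pieceB p q)) : angB y ^ q = 1 := by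
  rw [angB, div_pow, prRoot_pow hq, ← cP, div_self (cP_ne_zero y)]

/-- `U = c · (P)^{1/q}` on `B`. [folklore] -/
theorem cU_eq_angB_mul (hq : q ≠ 0) (y : ↥(pieceB p q)) : cU y.1 = angB y * prRoot q (cP y.1) := by
  rw [angB, div_mul_cancel₀ _ (prRoot_ne_zero hq (cP_ne_zero y))]

/-- The angular part is continuous on `B`. [folklore] -/
theorem continuous_angB (hq : q ≠ 0) : Continuous (angB (p := p) (q := q)) := by
  have h1 : Continuous fun y : ↥(pieceB p q) => cU y.1 := continuous_cU.comp continuous_subtype_val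
  have h2 : Continuous fun y : ↥(pieceB p q) => prRoot q (cP y.1) :=
    (continuousOn_prRoot q).comp_continuous (continuous_cP.comp continuous_subtype_val) fun y => re_cP_pos y.2
  exact h1.div h2 fun y => prRoot_ne_zero hq (cP_ne_zero y)

/-- **The index map `B → Fin q`.** [folklore] -/
def idxB (hq : q ≠ 0) : C(↥(pieceB p q), Fin q) :=
  ⟨fun y => rootIdx hq (angB y), continuous_rootIdx_comp hq (continuous_angB hq) (angB_pow hq)⟩

/-- The `j`-th base point `(μ^j, 0)` of `B` lies in the fibre: `(μ^j)^q - 0^p = 1`. [folklore] -/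
theorem basePtB_mem (hp : p ≠ 0) (hq : q ≠ 0) (j : ℕ) : mkPt (rootU q ^ j) 0 ∈ affFibre p q :=
  mkPt_mem_affFibre (by rw [zero_pow hp, rootU_pow_pow hq, sub_zero])

/-- The base points lie in `B` (`Re U^q = 1`). [folklore] -/
theorem basePtB_mem_pieceB (hp : p ≠ 0) (hq : q ≠ 0) (j : ℕ) :
    (⟨mkPt (rootU q ^ j) 0, basePtB_mem hp hq j⟩ : ↥(affFibre p q)) ∈ pieceB p q := by
  show 1 / 3 < (cP _).re
  rw [cP, cU]
  change 1 / 3 < (firstComplexCoord (mkPt _ _) ^ q).re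
  rw [firstComplexCoord_mkPt, rootU_pow_pow hq, Complex.one_re]
  norm_num

/-- **The section `Fin q → B`**, `j ↦ (μ^j, 0)`. [folklore] -/
def secB (hp : p ≠ 0) (hq : q ≠ 0) : C(Fin q, ↥(pieceB p q)) :=
  ⟨fun j => ⟨⟨mkPt (rootU q ^ (j : ℕ)) 0, basePtB_mem hp hq j⟩, basePtB_mem_pieceB hp hq j⟩,
    continuous_of_discreteTopology⟩

/-- `idx ∘ sec = id` on `B`. [folklore] -/
theorem idxB_secB (hp : p ≠ 0) (hq : q ≠ 0) (j : Fin q) : idxB hq (secB hp hq j) = j := by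
  show rootIdx hq (angB (secB hp hq j)) = j
  have h : angB (secB hp hq j) = rootU q ^ (j : ℕ) := by
    rw [angB, cP]
    show firstComplexCoord (mkPt _ 0) / prRoot q (firstComplexCoord (mkPt _ 0) ^ q) = _
    rw [firstComplexCoord_mkPt, rootU_pow_pow hq, prRoot_one, div_one]
  rw [h, rootIdx_rootU_pow]

/-- **The deformation of `B`**: `Ψ(s, y) = (c (1 + sᵖ V^p)^{1/q}, s V)`. [cite: Milnor1968, §9 Lemma 9.2 (Pham)] -/
def defB (s : ℝ) (y : ↥(pieceB p q)) : 𝔼 4 :=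
  mkPt (angB y * prRoot q (1 + ((s : ℂ) * cV y.1) ^ p)) ((s : ℂ) * cV y.1)

/-- Along the deformation `Re (1 + (sV)^p) > 1/3`. [folklore] -/
theorem re_one_add_pow_gt {s : ℝ} (hs0 : 0 ≤ s) (hs1 : s ≤ 1) (y : ↥(pieceB p q)) :
    1 / 3 < (1 + ((s : ℂ) * cV y.1) ^ p).re := by
  have hP : 1 / 3 < (cP y.1).re := y.2
  have hsq0 : 0 ≤ s ^ p := pow_nonneg hs0 p
  have hsq1 : s ^ p ≤ 1 := pow_le_one₀ hs0 hs1
  rw [mul_pow, ← Complex.ofReal_pow, Complex.add_re, Complex.one_re, Complex.re_ofReal_mul, cV_pow,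
    Complex.sub_re, Complex.one_re]
  rcases le_or_gt 0 ((cP y.1).re - 1) with h | h
  · nlinarith
  · nlinarith

/-- The deformation stays in the fibre. [folklore] -/
theorem defB_mem (hq : q ≠ 0) (s : ℝ) (y : ↥(pieceB p q)) : defB s y ∈ affFibre p q := by
  apply mkPt_mem_affFibre
  rw [mul_pow, angB_pow hq, one_mul, prRoot_pow hq]
  ring

/-- The deformation stays in `B`. [folklore] -/
theorem defB_mem_pieceB (hq : q ≠ 0) {s : ℝ} (hs0 : 0 ≤ s) (hs1 : s ≤ 1) (y : ↥(pieceB p q)) :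
    (⟨defB s y, defB_mem hq s y⟩ : ↥(affFibre p q)) ∈ pieceB p q := by
  show 1 / 3 < (cP _).re
  have h := re_one_add_pow_gt hs0 hs1 y (p := p)
  rw [cP, cU]
  change 1 / 3 < (firstComplexCoord (mkPt _ _) ^ q).re
  rw [firstComplexCoord_mkPt, mul_pow, angB_pow hq, one_mul, prRoot_pow hq]
  exact h

/-- The deformation as a map `[0,1] × B → B`. [folklore] -/
def defBMap (hq : q ≠ 0) (z : I × ↥(pieceB p q)) : ↥(pieceB p q) :=
  ⟨⟨defB z.1 z.2, defB_mem hq z.1 z.2⟩, defB_mem_pieceB hq z.1.2.1 z.1.2.2 z.2⟩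

/-- The deformation is continuous. [folklore] -/
theorem continuous_defBMap (hq : q ≠ 0) : Continuous (defBMap (p := p) (q := q) hq) := by
  refine Continuous.subtype_mk (Continuous.subtype_mk ?_ _) _
  have hs : Continuous fun z : I × ↥(pieceB p q) => ((z.1 : ℝ) : ℂ) :=
    Complex.continuous_ofReal.comp (continuous_subtype_val.comp continuous_fst)
  have hV : Continuous fun z : I × ↥(pieceB p q) => cV z.2.1 :=
    continuous_cV.comp (continuous_subtype_val.comp continuous_snd)
  have hsV : Continuous fun z : I × ↥(pieceB p q) => ((z.1 : ℝ) : ℂ) * cV z.2.1 := hs.mul hV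
  have hroot : Continuous fun z : I × ↥(pieceB p q) => prRoot q (1 + (((z.1 : ℝ) : ℂ) * cV z.2.1) ^ p) :=
    (continuousOn_prRoot q).comp_continuous (continuous_const.add (hsV.pow p)) fun z =>
      lt_trans (by norm_num) (re_one_add_pow_gt z.1.2.1 z.1.2.2 z.2)
  have hang : Continuous fun z : I × ↥(pieceB p q) => angB z.2 := (continuous_angB hq).comp continuous_snd
  exact continuous_mkPt.comp ((hang.mul hroot).prodMk hsV)

/-- At `s = 1` the deformation is the identity. [folklore] -/
theorem defB_one (hq : q ≠ 0) (y : ↥(pieceB p q)) : defB 1 y = (y.1 : 𝔼 4) := by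
  rw [defB, Complex.ofReal_one, one_mul, cV_pow, add_sub_cancel, ← cU_eq_angB_mul hq, mkPt_cU_cV]

/-- At `s = 0` the deformation is the base point `sec (idx y)`. [folklore] -/
theorem defB_zero (hp : p ≠ 0) (hq : q ≠ 0) (y : ↥(pieceB p q)) : defB 0 y = ((secB hp hq (idxB hq y)).1 : 𝔼 4) := by
  rw [defB, Complex.ofReal_zero, zero_mul, zero_pow hp, add_zero, prRoot_one, mul_one]
  show mkPt (angB y) 0 = mkPt (rootU q ^ (rootIdx hq (angB y) : ℕ)) 0
  rw [rootU_pow_rootIdx hq (angB_pow hq y)]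

/-- **The homotopy `id_B ≃ sec ∘ idx`.** [cite: Milnor1968, §9 Lemma 9.2] -/
def homotopyB (hp : p ≠ 0) (hq : q ≠ 0) :
    ContinuousMap.Homotopy (ContinuousMap.id ↥(pieceB p q)) ((secB hp hq).comp (idxB hq)) where
  toFun z := defBMap hq (σ z.1, z.2)
  continuous_toFun := (continuous_defBMap hq).comp ((unitInterval.continuous_symm.comp continuous_fst).prodMk continuous_snd)
  map_zero_left y := by
    apply Subtype.ext; apply Subtype.ext
    show defB (σ 0 : ℝ) y = (y.1 : 𝔼 4)
    rw [unitInterval.symm_zero, Set.Icc.coe_one, defB_one hq]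
  map_one_left y := by
    apply Subtype.ext; apply Subtype.ext
    show defB (σ 1 : ℝ) y = ((secB hp hq (idxB hq y)).1 : 𝔼 4)
    rw [unitInterval.symm_one, Set.Icc.coe_zero, defB_zero hp hq]

/-- **`B ≃ Fin q`**, a homotopy equivalence. [cite: Milnor1968, §9 Lemma 9.2] -/
def homotopyEquivB (hp : p ≠ 0) (hq : q ≠ 0) : ContinuousMap.HomotopyEquiv ↥(pieceB p q) (Fin q) where
  toFun := idxB hq
  invFun := secB hp hq
  left_inv := ⟨(homotopyB hp hq).symm⟩
  right_inv := by
    have h : (idxB hq).comp (secB hp hq) = ContinuousMap.id (Fin q) := ContinuousMap.ext (idxB_secB hp hq)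
    rw [h]

end PieceB

/-! ### The overlap `A ∩ B` deformation retracts onto `pq` points -/

section Overlap

variable {p q : ℕ}

/-- A point of `A ∩ B`, as a point of `A`. [folklore] -/
def ovA (y : ↥(pieceA p q ∩ pieceB p q)) : ↥(pieceA p q) := ⟨y.1, y.2.1⟩

/-- A point of `A ∩ B`, as a point of `B`. [folklore] -/
def ovB (y : ↥(pieceA p q ∩ pieceB p q)) : ↥(pieceB p q) := ⟨y.1, y.2.2⟩

/-- `ovA` is continuous. [folklore] -/
theorem continuous_ovA : Continuous (ovA (p := p) (q := q)) := continuous_subtype_val.subtype_mk _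

/-- `ovB` is continuous. [folklore] -/
theorem continuous_ovB : Continuous (ovB (p := p) (q := q)) := continuous_subtype_val.subtype_mk _

/-- **The index map `A ∩ B → Fin q × Fin p`.** [folklore] -/
def idxW (hp : p ≠ 0) (hq : q ≠ 0) : C(↥(pieceA p q ∩ pieceB p q), Fin q × Fin p) :=
  ⟨fun y => (idxB hq (ovB y), idxA hp (ovA y)),
    ((idxB hq).continuous.comp continuous_ovB).prodMk ((idxA hp).continuous.comp continuous_ovA)⟩

/-- `(1/2)^{1/n}` to the `n` is `1/2`. [folklore] -/
theorem prRoot_half_pow {n : ℕ} (hn : n ≠ 0) : prRoot n (1 / 2) ^ n = 1 / 2 := prRoot_pow hn _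

/-- The base point `(μ^j (1/2)^{1/q}, ν μ^k (1/2)^{1/p})` of `A ∩ B` lies in the fibre
(`U^q = 1/2`, `V^p = -1/2`). [folklore] -/
theorem basePtW_mem (hp : p ≠ 0) (hq : q ≠ 0) (j k : ℕ) :
    mkPt (rootU q ^ j * prRoot q (1 / 2)) (halfRoot p * rootU p ^ k * prRoot p (1 / 2)) ∈ affFibre p q :=
  mkPt_mem_affFibre (by
    rw [mul_pow, rootU_pow_pow hq, prRoot_half_pow hq, mul_pow, mul_pow, halfRoot_pow hp, rootU_pow_pow hp,
      prRoot_half_pow hp]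
    norm_num)

/-- At the base points `U^q = 1/2`. [folklore] -/
theorem cP_basePtW (hp : p ≠ 0) (hq : q ≠ 0) (j k : ℕ) :
    cP (⟨mkPt (rootU q ^ j * prRoot q (1 / 2)) (halfRoot p * rootU p ^ k * prRoot p (1 / 2)), basePtW_mem hp hq j k⟩ :
      ↥(affFibre p q)) = 1 / 2 := by
  rw [cP, cU]
  change firstComplexCoord (mkPt _ _) ^ q = 1 / 2
  rw [firstComplexCoord_mkPt, mul_pow, rootU_pow_pow hq, prRoot_half_pow hq, one_mul]

/-- The base points lie in `A ∩ B` (`Re U^q = 1/2`). [folklore] -/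
theorem basePtW_mem_inter (hp : p ≠ 0) (hq : q ≠ 0) (j k : ℕ) :
    (⟨mkPt (rootU q ^ j * prRoot q (1 / 2)) (halfRoot p * rootU p ^ k * prRoot p (1 / 2)), basePtW_mem hp hq j k⟩ :
      ↥(affFibre p q)) ∈ pieceA p q ∩ pieceB p q := by
  constructor
  · show (cP _).re < 2 / 3
    rw [cP_basePtW hp hq]; norm_num
  · show 1 / 3 < (cP _).re
    rw [cP_basePtW hp hq]; norm_num

/-- **The section `Fin q × Fin p → A ∩ B`.** [folklore] -/
def secW (hp : p ≠ 0) (hq : q ≠ 0) : C(Fin q × Fin p, ↥(pieceA p q ∩ pieceB p q)) :=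
  ⟨fun jk => ⟨⟨mkPt (rootU q ^ (jk.1 : ℕ) * prRoot q (1 / 2))
      (halfRoot p * rootU p ^ (jk.2 : ℕ) * prRoot p (1 / 2)), basePtW_mem hp hq jk.1 jk.2⟩,
      basePtW_mem_inter hp hq jk.1 jk.2⟩, continuous_of_discreteTopology⟩

/-- `(1/2)^{1/n} ≠ 0`. [folklore] -/
theorem prRoot_half_ne_zero {n : ℕ} (hn : n ≠ 0) : prRoot n (1 / 2) ≠ 0 := prRoot_ne_zero hn (by norm_num)

/-- The angular parts of the base point `(j, k)` are `μ_q^j` and `μ_p^k`. [folklore] -/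
theorem angB_secW (hp : p ≠ 0) (hq : q ≠ 0) (jk : Fin q × Fin p) : angB (ovB (secW hp hq jk)) = rootU q ^ (jk.1 : ℕ) := by
  have hP : cP (ovB (secW hp hq jk)).1 = 1 / 2 := cP_basePtW hp hq jk.1 jk.2
  have hU : cU (ovB (secW hp hq jk)).1 = rootU q ^ (jk.1 : ℕ) * prRoot q (1 / 2) := firstComplexCoord_mkPt _ _
  rw [angB, hP, hU, mul_div_cancel_right₀ _ (prRoot_half_ne_zero hq)]

/-- The `A`-angular part of the base point `(j, k)` is `μ_p^k`. [folklore] -/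
theorem angA_secW (hp : p ≠ 0) (hq : q ≠ 0) (jk : Fin q × Fin p) : angA (ovA (secW hp hq jk)) = rootU p ^ (jk.2 : ℕ) := by
  have hP : cP (ovA (secW hp hq jk)).1 = 1 / 2 := cP_basePtW hp hq jk.1 jk.2
  have hV : cV (ovA (secW hp hq jk)).1 = halfRoot p * rootU p ^ (jk.2 : ℕ) * prRoot p (1 / 2) :=
    secondComplexCoord_mkPt _ _
  rw [angA, hP, hV, show (1 : ℂ) - 1 / 2 = 1 / 2 by norm_num, mul_assoc, mul_comm (rootU p ^ _), ← mul_assoc,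
    mul_div_cancel_left₀ _ (mul_ne_zero (halfRoot_ne_zero p) (prRoot_half_ne_zero hp))]

/-- `idx ∘ sec = id` on `A ∩ B`. [folklore] -/
theorem idxW_secW (hp : p ≠ 0) (hq : q ≠ 0) (jk : Fin q × Fin p) : idxW hp hq (secW hp hq jk) = jk := by
  show (rootIdx hq (angB (ovB (secW hp hq jk))), rootIdx hp (angA (ovA (secW hp hq jk)))) = jk
  rw [angB_secW, angA_secW, rootIdx_rootU_pow, rootIdx_rootU_pow]

/-- The interpolated value `P_s = 1/2 + s (P - 1/2)` of `U^q` along the deformation of `A ∩ B`.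
[folklore] -/
def midP (s : ℝ) (y : ↥(pieceA p q ∩ pieceB p q)) : ℂ := 1 / 2 + (s : ℂ) * (cP y.1 - 1 / 2)

/-- `Re P_s ∈ (1/3, 2/3)` for `s ∈ [0, 1]`. [folklore] -/
theorem re_midP_mem {s : ℝ} (hs0 : 0 ≤ s) (hs1 : s ≤ 1) (y : ↥(pieceA p q ∩ pieceB p q)) :
    1 / 3 < (midP s y).re ∧ (midP s y).re < 2 / 3 := by
  have hA : (cP y.1).re < 2 / 3 := y.2.1
  have hB : 1 / 3 < (cP y.1).re := y.2.2
  have hre : (midP s y).re = 1 / 2 + s * ((cP y.1).re - 1 / 2) := by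
    simp [midP]
  rw [hre]
  constructor <;> nlinarith

/-- **The deformation of `A ∩ B`**: `Θ(s, y) = (c_B P_s^{1/q}, c_A ν (1 - P_s)^{1/p})`.
[cite: Milnor1968, §9 Lemma 9.2 (Pham)] -/
def defW (s : ℝ) (y : ↥(pieceA p q ∩ pieceB p q)) : 𝔼 4 :=
  mkPt (angB (ovB y) * prRoot q (midP s y)) (angA (ovA y) * (halfRoot p * prRoot p (1 - midP s y)))

/-- Along the deformation `U^q = P_s`. [folklore] -/
theorem firstComplexCoord_defW_pow (hq : q ≠ 0) (s : ℝ) (y : ↥(pieceA p q ∩ pieceB p q)) :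
    firstComplexCoord (defW s y) ^ q = midP s y := by
  rw [defW, firstComplexCoord_mkPt, mul_pow, angB_pow hq, one_mul, prRoot_pow hq]

/-- The deformation stays in the fibre. [folklore] -/
theorem defW_mem (hp : p ≠ 0) (hq : q ≠ 0) (s : ℝ) (y : ↥(pieceA p q ∩ pieceB p q)) : defW s y ∈ affFibre p q := by
  rw [mem_affFibre, milnorPoly, firstComplexCoord_defW_pow hq, defW, secondComplexCoord_mkPt, mul_pow,
    angA_pow hp, one_mul, mul_pow, halfRoot_pow hp, prRoot_pow hp]
  ring

/-- The deformation stays in `A ∩ B`. [folklore] -/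
theorem defW_mem_inter (hp : p ≠ 0) (hq : q ≠ 0) {s : ℝ} (hs0 : 0 ≤ s) (hs1 : s ≤ 1) (y : ↥(pieceA p q ∩ pieceB p q)) :
    (⟨defW s y, defW_mem hp hq s y⟩ : ↥(affFibre p q)) ∈ pieceA p q ∩ pieceB p q := by
  have h := re_midP_mem hs0 hs1 y
  have hP : cP (⟨defW s y, defW_mem hp hq s y⟩ : ↥(affFibre p q)) = midP s y :=
    firstComplexCoord_defW_pow hq s y
  constructor
  · show (cP _).re < 2 / 3
    rw [hP]; exact h.2
  · show 1 / 3 < (cP _).re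
    rw [hP]; exact h.1

/-- The deformation as a map `[0,1] × (A ∩ B) → A ∩ B`. [folklore] -/
def defWMap (hp : p ≠ 0) (hq : q ≠ 0) (z : I × ↥(pieceA p q ∩ pieceB p q)) : ↥(pieceA p q ∩ pieceB p q) :=
  ⟨⟨defW z.1 z.2, defW_mem hp hq z.1 z.2⟩, defW_mem_inter hp hq z.1.2.1 z.1.2.2 z.2⟩

/-- The deformation is continuous. [folklore] -/
theorem continuous_defWMap (hp : p ≠ 0) (hq : q ≠ 0) : Continuous (defWMap (p := p) (q := q) hp hq) := by
  refine Continuous.subtype_mk (Continuous.subtype_mk ?_ _) _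
  have hs : Continuous fun z : I × ↥(pieceA p q ∩ pieceB p q) => ((z.1 : ℝ) : ℂ) :=
    Complex.continuous_ofReal.comp (continuous_subtype_val.comp continuous_fst)
  have hP : Continuous fun z : I × ↥(pieceA p q ∩ pieceB p q) => cP z.2.1 :=
    continuous_cP.comp (continuous_subtype_val.comp continuous_snd)
  have hmid : Continuous fun z : I × ↥(pieceA p q ∩ pieceB p q) => midP z.1 z.2 :=
    continuous_const.add (hs.mul (hP.sub continuous_const))
  have hroot1 : Continuous fun z : I × ↥(pieceA p q ∩ pieceB p q) => prRoot q (midP z.1 z.2) :=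
    (continuousOn_prRoot q).comp_continuous hmid fun z =>
      lt_trans (by norm_num) (re_midP_mem z.1.2.1 z.1.2.2 z.2).1
  have hroot2 : Continuous fun z : I × ↥(pieceA p q ∩ pieceB p q) => prRoot p (1 - midP z.1 z.2) :=
    (continuousOn_prRoot p).comp_continuous (continuous_const.sub hmid) fun z => by
      have h := (re_midP_mem z.1.2.1 z.1.2.2 z.2).2
      show 0 < (1 - midP z.1 z.2).re
      rw [Complex.sub_re, Complex.one_re]; linarith
  have hangA : Continuous fun z : I × ↥(pieceA p q ∩ pieceB p q) => angA (ovA z.2) :=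
    (continuous_angA hp).comp (continuous_ovA.comp continuous_snd)
  have hangB : Continuous fun z : I × ↥(pieceA p q ∩ pieceB p q) => angB (ovB z.2) :=
    (continuous_angB hq).comp (continuous_ovB.comp continuous_snd)
  exact continuous_mkPt.comp ((hangB.mul hroot1).prodMk (hangA.mul (continuous_const.mul hroot2)))

/-- At `s = 1`, `P_s = P` and the deformation is the identity. [folklore] -/
theorem defW_one (hp : p ≠ 0) (hq : q ≠ 0) (y : ↥(pieceA p q ∩ pieceB p q)) : defW 1 y = (y.1 : 𝔼 4) := by
  have hmid : midP 1 y = cP y.1 := by rw [midP, Complex.ofReal_one, one_mul]; ring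
  rw [defW, hmid]
  have hU : angB (ovB y) * prRoot q (cP y.1) = cU y.1 := (cU_eq_angB_mul hq (ovB y)).symm
  have hV : angA (ovA y) * (halfRoot p * prRoot p (1 - cP y.1)) = cV y.1 := (cV_eq_angA_mul hp (ovA y)).symm
  rw [hU, hV, mkPt_cU_cV]

/-- At `s = 0`, `P_s = 1/2` and the deformation is the base point `sec (idx y)`. [folklore] -/
theorem defW_zero (hp : p ≠ 0) (hq : q ≠ 0) (y : ↥(pieceA p q ∩ pieceB p q)) : defW 0 y = ((secW hp hq (idxW hp hq y)).1 : 𝔼 4) := by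
  have hmid : midP 0 y = 1 / 2 := by rw [midP, Complex.ofReal_zero, zero_mul, add_zero]
  rw [defW, hmid, show (1 : ℂ) - 1 / 2 = 1 / 2 by norm_num]
  show mkPt (angB (ovB y) * prRoot q (1 / 2)) (angA (ovA y) * (halfRoot p * prRoot p (1 / 2))) =
    mkPt (rootU q ^ (rootIdx hq (angB (ovB y)) : ℕ) * prRoot q (1 / 2))
      (halfRoot p * rootU p ^ (rootIdx hp (angA (ovA y)) : ℕ) * prRoot p (1 / 2))
  rw [rootU_pow_rootIdx hq (angB_pow hq _), rootU_pow_rootIdx hp (angA_pow hp _)]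
  congr 1
  ring

/-- **The homotopy `id_{A ∩ B} ≃ sec ∘ idx`.** [cite: Milnor1968, §9 Lemma 9.2] -/
def homotopyW (hp : p ≠ 0) (hq : q ≠ 0) : ContinuousMap.Homotopy (ContinuousMap.id ↥(pieceA p q ∩ pieceB p q))
    ((secW hp hq).comp (idxW hp hq)) where
  toFun z := defWMap hp hq (σ z.1, z.2)
  continuous_toFun := (continuous_defWMap hp hq).comp ((unitInterval.continuous_symm.comp continuous_fst).prodMk continuous_snd)
  map_zero_left y := by
    apply Subtype.ext; apply Subtype.ext
    show defW (σ 0 : ℝ) y = (y.1 : 𝔼 4)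
    rw [unitInterval.symm_zero, Set.Icc.coe_one, defW_one hp hq]
  map_one_left y := by
    apply Subtype.ext; apply Subtype.ext
    show defW (σ 1 : ℝ) y = ((secW hp hq (idxW hp hq y)).1 : 𝔼 4)
    rw [unitInterval.symm_one, Set.Icc.coe_zero, defW_zero hp hq]

/-- **`A ∩ B ≃ Fin q × Fin p`**, a homotopy equivalence. [cite: Milnor1968, §9 Lemma 9.2] -/
def homotopyEquivW (hp : p ≠ 0) (hq : q ≠ 0) : ContinuousMap.HomotopyEquiv ↥(pieceA p q ∩ pieceB p q) (Fin q × Fin p) where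
  toFun := idxW hp hq
  invFun := secW hp hq
  left_inv := ⟨(homotopyW hp hq).symm⟩
  right_inv := by
    have h : (idxW hp hq).comp (secW hp hq) = ContinuousMap.id (Fin q × Fin p) :=
      ContinuousMap.ext (idxW_secW hp hq)
    rw [h]

end Overlap

/-! ### Path-connectedness of the affine fibre -/

section Connected

variable {p q : ℕ}

/-- A homotopy from the identity joins each point to its image. [folklore] -/
theorem joined_of_homotopy_id {Y : Type*} [TopologicalSpace Y] {g : C(Y, Y)}
    (H : ContinuousMap.Homotopy (ContinuousMap.id Y) g) (y : Y) : Joined y (g y) :=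
  ⟨{ toFun := fun t => H (t, y),
      continuous_toFun := H.continuous.comp (continuous_id.prodMk continuous_const),
      source' := H.apply_zero y,
      target' := H.apply_one y }⟩

/-- Joined points of a subspace are joined in the ambient space. [folklore] -/
theorem joined_val_of_joined {Y : Type*} [TopologicalSpace Y] {S : Set Y} {a b : ↥S} (h : Joined a b) :
    Joined (a : Y) (b : Y) := by
  obtain ⟨γ⟩ := h
  exact ⟨γ.map continuous_subtype_val⟩

/-- **The affine Milnor fibre `{U^q - V^p = 1}` is path connected** (`p, q ≥ 1`): every point of
`A` (resp. `B`) is joined inside `A` (resp. `B`) to a base point `(0, ν μ_p^k)` (resp. `(μ_q^j, 0)`),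
and these are joined through the base points of `A ∩ B`. (Milnor 1968, §9: the fibre deformation
retracts onto the connected join `Ω_q * Ω_p`.) [cite: Milnor1968, §9 Lemma 9.2] -/
theorem pathConnectedSpace_affFibre (hp : p ≠ 0) (hq : q ≠ 0) : PathConnectedSpace ↥(affFibre p q) := by
  -- the base point `(1, 0)` of `B` (`j = 0`)
  let b₀ : ↥(affFibre p q) := (secB hp hq ⟨0, Nat.pos_of_ne_zero hq⟩).1
  -- every base point of `A` is joined to every base point of `B`
  have hAB : ∀ (j : Fin q) (k : Fin p), Joined ((secA hp hq k).1 : ↥(affFibre p q)) (secB hp hq j).1 := by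
    intro j k
    let w := secW hp hq (j, k)
    -- `w` is joined in `A` to `secA k'` with `k' = idxA (ovA w) = k`, and in `B` to `secB j`
    have h1 : Joined (ovA w) (secA hp hq (idxA hp (ovA w))) := joined_of_homotopy_id (homotopyA hp hq) (ovA w)
    have h2 : Joined (ovB w) (secB hp hq (idxB hq (ovB w))) := joined_of_homotopy_id (homotopyB hp hq) (ovB w)
    have hk : idxA hp (ovA w) = k := by
      show rootIdx hp (angA (ovA (secW hp hq (j, k)))) = k
      rw [angA_secW, rootIdx_rootU_pow]
    have hj : idxB hq (ovB w) = j := by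
      show rootIdx hq (angB (ovB (secW hp hq (j, k)))) = j
      rw [angB_secW, rootIdx_rootU_pow]
    rw [hk] at h1
    rw [hj] at h2
    exact (joined_val_of_joined h1).symm.trans (joined_val_of_joined h2)
  -- every point is joined to `b₀`
  have key : ∀ y : ↥(affFibre p q), Joined y b₀ := by
    intro y
    rcases (show y ∈ pieceA p q ∪ pieceB p q by rw [pieceA_union_pieceB]; trivial) with hy | hy
    · have h1 : Joined (⟨y, hy⟩ : ↥(pieceA p q)) (secA hp hq (idxA hp ⟨y, hy⟩)) :=
        joined_of_homotopy_id (homotopyA hp hq) ⟨y, hy⟩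
      exact (joined_val_of_joined h1).trans (hAB _ _)
    · have h1 : Joined (⟨y, hy⟩ : ↥(pieceB p q)) (secB hp hq (idxB hq ⟨y, hy⟩)) :=
        joined_of_homotopy_id (homotopyB hp hq) ⟨y, hy⟩
      have h2 := hAB (idxB hq ⟨y, hy⟩) ⟨0, Nat.pos_of_ne_zero hp⟩
      have h3 := hAB ⟨0, Nat.pos_of_ne_zero hq⟩ ⟨0, Nat.pos_of_ne_zero hp⟩
      exact ((joined_val_of_joined h1).trans h2.symm).trans h3
  exact ⟨⟨b₀⟩, fun x y => (key x).trans (key y).symm⟩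

end Connected

/-! ### Assembly: the first Betti number of the affine fibre -/

section Betti

variable {p q : ℕ}

/-- `Fin q × Fin p ≃ₜ Fin (q * p)` (discrete spaces). [folklore] -/
def finProdHomeomorph (q p : ℕ) : (Fin q × Fin p) ≃ₜ Fin (q * p) where
  toEquiv := finProdFinEquiv
  continuous_toFun := continuous_of_discreteTopology
  continuous_invFun := continuous_of_discreteTopology

/-- `H₀(A; ℤ) ≅ ℤᵖ`. [cite: Milnor1968, §9 Lemma 9.2] -/
theorem nonempty_linearEquiv_pieceA (hp : p ≠ 0) (hq : q ≠ 0) :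
    Nonempty (singularHomology ℤ ℤ ↥(pieceA p q) 0 ≃ₗ[ℤ] (Fin p → ℤ)) := by
  obtain ⟨e⟩ := singularHomology.nonempty_zeroLinearEquivFin_of_ne_zero ℤ ℤ hp
  exact ⟨(singularHomology.isoOfHomotopyEquiv ℤ ℤ (homotopyEquivA hp hq) 0).toLinearEquiv ≪≫ₗ e⟩

/-- `H₀(B; ℤ) ≅ ℤ^q`. [cite: Milnor1968, §9 Lemma 9.2] -/
theorem nonempty_linearEquiv_pieceB (hp : p ≠ 0) (hq : q ≠ 0) :
    Nonempty (singularHomology ℤ ℤ ↥(pieceB p q) 0 ≃ₗ[ℤ] (Fin q → ℤ)) := by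
  obtain ⟨e⟩ := singularHomology.nonempty_zeroLinearEquivFin_of_ne_zero ℤ ℤ hq
  exact ⟨(singularHomology.isoOfHomotopyEquiv ℤ ℤ (homotopyEquivB hp hq) 0).toLinearEquiv ≪≫ₗ e⟩

/-- `H₀(A ∩ B; ℤ) ≅ ℤ^{qp}`. [cite: Milnor1968, §9 Lemma 9.2] -/
theorem nonempty_linearEquiv_overlap (hp : p ≠ 0) (hq : q ≠ 0) :
    Nonempty (singularHomology ℤ ℤ ↥(pieceA p q ∩ pieceB p q) 0 ≃ₗ[ℤ] (Fin (q * p) → ℤ)) := by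
  obtain ⟨e⟩ := singularHomology.nonempty_zeroLinearEquivFin_of_ne_zero ℤ ℤ (mul_ne_zero hq hp)
  exact ⟨(singularHomology.isoOfHomotopyEquiv ℤ ℤ (homotopyEquivW hp hq) 0).toLinearEquiv ≪≫ₗ
    (singularHomology.mapIso ℤ ℤ (finProdHomeomorph q p) 0).toLinearEquiv ≪≫ₗ e⟩

/-- `H₁(A; ℤ) = 0`. [cite: Milnor1968, §9 Lemma 9.2] -/
theorem isZero_singularHomology_one_pieceA (hp : p ≠ 0) (hq : q ≠ 0) : IsZero (singularHomology ℤ ℤ ↥(pieceA p q) 1) :=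
  (singularHomology.isZero_fin ℤ ℤ p one_ne_zero).of_iso (singularHomology.isoOfHomotopyEquiv ℤ ℤ (homotopyEquivA hp hq) 1)

/-- `H₁(B; ℤ) = 0`. [cite: Milnor1968, §9 Lemma 9.2] -/
theorem isZero_singularHomology_one_pieceB (hp : p ≠ 0) (hq : q ≠ 0) : IsZero (singularHomology ℤ ℤ ↥(pieceB p q) 1) :=
  (singularHomology.isZero_fin ℤ ℤ q one_ne_zero).of_iso (singularHomology.isoOfHomotopyEquiv ℤ ℤ (homotopyEquivB hp hq) 1)

/-- **Milnor's Theorem 9.1 for the torus-knot polynomial: `H₁` of the affine Milnor fibre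
`{U^q - V^p = 1}` is finitely generated of rank `(p-1)(q-1)` over `ℤ`** (Brieskorn–Pham,
`μ = (q-1)(p-1)`), here from the Mayer–Vietoris count `rank H₁ + p + q = pq + 1` for the cover
`A ∪ B`. [cite: Milnor1968, §9 Thm. 9.1 (PDF p. 39)] -/
theorem finrank_singularHomology_one_affFibre (hp : p ≠ 0) (hq : q ≠ 0) :
    Module.finrank ℤ (singularHomology ℤ ℤ ↥(affFibre p q) 1) = (p - 1) * (q - 1) ∧
      Module.Finite ℤ (singularHomology ℤ ℤ ↥(affFibre p q) 1) := by
  haveI := pathConnectedSpace_affFibre hp hq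
  obtain ⟨eA⟩ := nonempty_linearEquiv_pieceA hp hq
  obtain ⟨eB⟩ := nonempty_linearEquiv_pieceB hp hq
  obtain ⟨eW⟩ := nonempty_linearEquiv_overlap hp hq
  obtain ⟨h, hfin⟩ := mayerVietoris_finrank_one (S := ℤ) (pieceA p q) (pieceB p q) isOpen_pieceA isOpen_pieceB
    pieceA_union_pieceB (isZero_singularHomology_one_pieceA hp hq) (isZero_singularHomology_one_pieceB hp hq)
    eA eB eW
  refine ⟨?_, hfin⟩
  obtain ⟨p', rfl⟩ := Nat.exists_eq_succ_of_ne_zero hp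
  obtain ⟨q', rfl⟩ := Nat.exists_eq_succ_of_ne_zero hq
  simp only [Nat.succ_eq_add_one, Nat.add_sub_cancel] at h ⊢
  have e : (q' + 1) * (p' + 1) = p' * q' + p' + q' + 1 := by ring
  omega

end Betti

end TorusKnotMilnor

end Literature.Topology.FourManifolds
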